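import Mathlib.AlgebraicGeometry.EllipticCurve.Affine.Point
import Mathlib.NumberTheory.LegendreSymbol.Basic

/-!
# Cell `bsd-f1-sign2`, lens `-an` g8 (MEMO-an v1.18.1, AN-24L): THE DOOR BIT AT A TRANSPOSITION PRIME IS A LEGENDRE SYMBOL — `LegendreDoorCriterion`

STATEMENTS ONLY + PROVED glue (two plain `def … : Prop` = one candidate SUPPORT LEMMA in two phrasings — a THEOREM on paper (2-isogeny descent over a
finite field), unproved in the tree, nothing asserted, no `@[conjecture]` tag (same treatment as T-q₀ / AN-24S); `legendreSym_val_eq_neg_one_iff` and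
`legendreDoorCriterion_iff_primed` PROVED; Mathlib-only; no named Literature fact, no `sorry`, no instance, no notation).

TYPER FILING (seat `bsd-f1-sign2-ty` g4; planner ask D-an-30 «-ty / any prover: land AN-24L as a support lemma under F1Sign2/»; CANDIDATES.md row AN-24L):
the two `def` bodies VERBATIM from the planner's `HOME/MEMO-an-data/g8/Sketch_v14.lean` 80cdf898b236c694 (-an g8 2026-08-28T02:36:49Z, MEMO-an v1.18.1 a49564068b188a34,
rows `CANDIDATES-rows-an-v1181.md` cd7d7f323be75124; rc 0 / 0 warn / 0 sorry; evidence #34/#38 on stmt-BirchSwinnertonDyer-23715); namespace as in the sketch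
(`Summit.BirchSwinnertonDyer.Rank1Residual.F1Sign2.SingleDoor`); typer edits = this header, the two docstrings, `import Mathlib` ↦ the two specific Mathlib
modules, and the planner's pointwise `example` promoted to the two named glue theorems. CENSUS of record (planner's): ENGINE I kit j296819 — door bit
`= [legendreSym q (x(P₀) − e_q) = −1]` on 18 000/18 000 (curve, q) pairs (3 000 `Δ < 0` rank-1 curves × 6 least transposition primes) against division points.
PROOF STATUS: open (D-an-30); size estimate L — variable change to the `T`-at-origin model `Y² = X³ + AX² + BX`, the Kummer identity
`X_P · X_Q · X_(P+Q) = ν²`, and the index count `[W(𝔽_q) : φ̂ W′(𝔽_q)] = 2` (needs `#W(𝔽_q) = #W′(𝔽_q)` or an equivalent character-sum identity), none of it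
in Mathlib. REF1-AUDIT-v1 §61 (4ea9177ad007b797, 2026-08-28T02:59:43Z; evidence `HOME/REF1-data/b61/`; audited ON THIS draft c3cd8d436da56ae0): **AN-24L `SingleDoor.LegendreDoorCriterion` / `LegendreDoorCriterion'` SURVIVE THEOREM-GRADE — -ty CLEARED TO FILE as is.** rc 0 / 24 s; BC7 CLEAN ×2 (∀×5 H×6 ⊢ ↔; P1 4.4 s/P2 4.0/P2h 2.2/P3 1.4 and 1.6/3.9/2.2/1.5); glue theorems axioms standard; truth on paper = full 2-descent over 𝔽_q (c = 4(z − e)g with g irreducible; H¹(𝔽_q, W[2]) = ker N ≅ 𝔽₂ inside 𝔽_q^×/□ × 𝔽_{q²}^×/□ with N an iso on the quadratic factor ⇒ the first Kummer coordinate x − e alone detects 2-divisibility; equivalently Silverman X.4.9 φ̂-descent); edge x = e excluded by (2y + a₁x + a₃)² = 4x³ + b₂x² + 2b₄x + b₆; q = 3 fine; independent exact engine `REF1-data/b61/ff_check.py`: 125 one-root random general-Weierstrass curves over 𝔽_q, q ≤ 23, 1 108 points, 0 mismatches (second engine to -an's j296819 18 000/18 000); mutation: dropping «exactly one root» gives 134/476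 mismatches at q = 13 — load-bearing; `IsElliptic`, `q ≠ 2` used. REF2-PLACEMENT: not a placement object (support lemma = Silverman AEC X.4.9-type descent over a finite field; in print KNOWN in substance); no REF2 ask. PARTITION: none moved; beyond-print theorem: no. bears_on: `stmt-BirchSwinnertonDyer-23715` (line egg-kolyvagin-two v5: the door
conjunct; D-an-31 door engine for -data and -desc) and `stmt-BirchSwinnertonDyer-19099`.

LANDING NOTE (-ty g12, 2026-08-28T20:4xZ; text only, statements untouched): **AN-24L IS NOW A TREE THEOREM** —
`Summit.BirchSwinnertonDyer.BirchSwinnertonDyer.Theorems.GenusKolyTransp.legendreDoorCriterion_holds : LegendreDoorCriterion` and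
`…GenusKolyTransp.legendreDoorCriterion'_holds : LegendreDoorCriterion'` (gk2-p4 g14, p665861 ACCEPTED, file
`Summits/BirchSwinnertonDyer/BirchSwinnertonDyer/Theorems/GenusKolyvaginAtTwoGenusPrimitiveSupplyAtTwoLegendreDoor.lean`, std axioms): the `→` half
(certifying: `R + R = (x, y) ⟹ x − e` is a square, over ANY field with `2 ≠ 0`) is `…GenusKolyTransp.legendreDoorCriterion_mp` /
`isSquare_sub_root_of_add_self_eq` / `not_exists_two_smul_eq_of_legendreSym_eq_neg_one` (gk2-p4 g13, p664227, file `…LegendreDoorHalf.lean`, via the tree's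
`EggDoubling.addX_self_mul_psiTwo` duplication formula); the `←` half is `…GenusKolyTransp.legendreDoorCriterion_mpr` (gk2-p4 g14: explicit halving inside
`ZMod q`, no field extension — factor ψ₂ = 4(z − e)(z² + pz + r) with the quadratic rootless, pick the sign of t = √(x − e) making c = 2x + p + 𝐲⁄t a square);
`legendreDoorCriterion_of_converse` (p664227) is the reduction used.  Consumers: feed `(h : LegendreDoorCriterion)` with `legendreDoorCriterion_holds`.
PROOF STATUS below («open (D-an-30); size estimate L») is SUPERSEDED by this note.  REF2 (g40, 20:15:22Z): KNOWN-type
[cite: SilvermanAEC2009, Prop. X.4.9, Ex. X.4.8, III.2.3 (d)], kernel-new in its field-general binders; beyond-print no.  PARTITION: none; BSD not proved.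

Planner's summary (verbatim): # Sketch_v14 (-an g8) — AN-24L: the door bit at a transposition prime is a Legendre symbol.

Finite-field statement (self-contained, Mathlib only): over `ZMod q`, `q` an odd prime, if the
2-division cubic `4z³ + b₂z² + 2b₄z + b₆` of an elliptic curve `W` has exactly one root `e`, then an
affine point `P = (x, y)` with `2y + a₁x + a₃ ≠ 0` (i.e. `P ∉ W[2]`) is divisible by 2 in
`W(ZMod q)` iff `x − e` is a square.  Door open at `q` ⟺ `¬ IsSquare (x(P₀) − e_q)`
⟺ `legendreSym q (x(P₀) − e_q) = -1`.  Verified numerically 18 000/18 000 against ENGINE I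
(kit j296819).  Proof on paper: 2-isogeny descent over `𝔽_q` — the 2-Sylow subgroup of `W(𝔽_q)` is
cyclic (one rational 2-torsion point `T = (e, ·)`), so `2·W(𝔽_q) = φ̂(W'(𝔽_q))` for the isogeny
`φ` with kernel `⟨T⟩`, and the connecting map `δ_φ̂ : W(𝔽_q)/φ̂ W'(𝔽_q) ↪ 𝔽_q^×/𝔽_q^{×2}` is
`P ↦ x(P) − e`.
-/


namespace Summit.BirchSwinnertonDyer.Rank1Residual.F1Sign2.SingleDoor

open WeierstrassCurve

/-- **AN-24L `LegendreDoorCriterion` (candidate SUPPORT LEMMA — a THEOREM on paper, unproved in the tree; plain `def`, nothing asserted).**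
For an odd prime `q`, an elliptic curve `W` over `ZMod q` whose 2-division cubic `4z³ + b₂z² + 2b₄z + b₆` has exactly one root `e`
(equivalently `W(𝔽_q)[2] = {O, T}` with `x(T) = e`), and an affine point `P = (x, y)` with `2y + a₁x + a₃ ≠ 0` (i.e. `P ∉ W[2]`):
`P ∈ 2·W(𝔽_q)` iff `x − e` is a square in `𝔽_q`.  Proof on paper: 2-isogeny descent over `𝔽_q` — the 2-Sylow subgroup of `W(𝔽_q)`
is cyclic, `#W(𝔽_q) = #W′(𝔽_q)` for the 2-isogenous `W′ = W/⟨T⟩`, hence `2·W(𝔽_q) = φ̂(W′(𝔽_q))` (both of index 2), and the connecting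
map `δ_φ̂ : W(𝔽_q)/φ̂W′(𝔽_q) ↪ 𝔽_q^×/𝔽_q^{×2}` is `P ↦ x(P) − e` [cite: SilvermanAEC2009, Ex. X.4.8 and Prop. X.4.9
(Descent via Two-Isogeny: `δ(X, Y) = X` away from `O, T`; 1st ed. 1986 pp. 301–302 = corpus `book:silverman1986-arithmetic-elliptic-curves` p0317–p0318)].  Use in the cell: at a transposition prime `q₀` of a `Δ < 0` curve the door bit `MeetsNonNormAt W q₀` becomes the
Legendre-symbol check `((x(P₀) − e_{q₀})/q₀) = −1` (MEMO-an v1.18.1 AN-24L; verified 18 000/18 000 against division points, ENGINE I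
kit j296819).  D-an-30: proof open to any prover. -/
def LegendreDoorCriterion : Prop :=
  ∀ (q : ℕ) [Fact q.Prime], q ≠ 2 →
  ∀ (W : WeierstrassCurve (ZMod q)) [W.IsElliptic] (e : ZMod q),
    (∀ z : ZMod q, 4 * z ^ 3 + W.b₂ * z ^ 2 + 2 * W.b₄ * z + W.b₆ = 0 ↔ z = e) →
    ∀ (x y : ZMod q) (h : W.toAffine.Nonsingular x y), 2 * y + W.a₁ * x + W.a₃ ≠ 0 →
      ((∃ R : W.toAffine.Point, 2 • R = Affine.Point.some x y h) ↔ IsSquare (x - e))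

/-- **AN-24L, primed form `LegendreDoorCriterion'`**: the same criterion phrased with `legendreSym` (door OPEN ⟺ symbol `= -1`); equivalent to
`LegendreDoorCriterion` by `legendreDoorCriterion_iff_primed` below (plain `def`, nothing asserted). -/
def LegendreDoorCriterion' : Prop :=
  ∀ (q : ℕ) [Fact q.Prime], q ≠ 2 →
  ∀ (W : WeierstrassCurve (ZMod q)) [W.IsElliptic] (e : ZMod q),
    (∀ z : ZMod q, 4 * z ^ 3 + W.b₂ * z ^ 2 + 2 * W.b₄ * z + W.b₆ = 0 ↔ z = e) →
    ∀ (x y : ZMod q) (h : W.toAffine.Nonsingular x y), 2 * y + W.a₁ * x + W.a₃ ≠ 0 →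
      ((¬ ∃ R : W.toAffine.Point, 2 • R = Affine.Point.some x y h) ↔ legendreSym q (x - e).val = -1)

/-- Pointwise dictionary (glue, PROVED): the Legendre symbol of `a` is `-1` iff `a` is a non-square in `ZMod q` (for `a = 0` both
sides are false). [folklore] -/
theorem legendreSym_val_eq_neg_one_iff (q : ℕ) [Fact q.Prime] (a : ZMod q) :
    legendreSym q a.val = -1 ↔ ¬ IsSquare a := by
  have : ((a.val : ℤ) : ZMod q) = a := by simp
  rw [legendreSym.eq_neg_one_iff, this]

/-- Glue (PROVED): the two phrasings of AN-24L are equivalent. [folklore] -/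
theorem legendreDoorCriterion_iff_primed : LegendreDoorCriterion ↔ LegendreDoorCriterion' := by
  unfold LegendreDoorCriterion LegendreDoorCriterion'
  refine forall_congr' fun q => forall_congr' fun _ => forall_congr' fun _ => forall_congr' fun W =>
    forall_congr' fun _ => forall_congr' fun e => forall_congr' fun _ => forall_congr' fun x =>
    forall_congr' fun y => forall_congr' fun h => forall_congr' fun _ => ?_
  rw [legendreSym_val_eq_neg_one_iff, not_iff_not]

end Summit.BirchSwinnertonDyer.Rank1Residual.F1Sign2.SingleDoor
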